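import Mathlib
import HarnessLib.Audit
import Literature.Analysis.FluidPDE.NSWave0
import HarnessLib

/-!
# NavierStokesBreakdownPeriodic — CONJECTURE (obligation of NavierStokesRegularity/NavierStokesRegularity)

Unproven conjecture migrated by the gate from `Literature/Analysis/FluidPDE/NSWave0.lean` (`Literature.Analysis.FluidPDE.NavierStokesBreakdownPeriodic`): unproven conjectures are obligations of our
theories, not literature facts (human ruling 2026-08-15). Provenance: FeffermanClay2006. Routes use it as a crux item or via
`--conditional-bridge --conditional-on NavierStokesBreakdownPeriodic`; a proof goes in the sibling `Theorems/NavierStokesBreakdownPeriodicHolds.lean` as `theorem NavierStokesBreakdownPeriodic_holds : NavierStokesBreakdownPeriodic` so this file stays a conjecture LEAF that Literature/ may import.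
-/

namespace Summit.NavierStokesRegularity.NavierStokesRegularity

open Literature Literature.Analysis Literature.Analysis.FluidPDE
open scoped ContDiff ENNReal
open Laplacian MeasureTheory
local notation "ℝ³" => EuclideanSpace ℝ (Fin 3)

/-- OPEN CONJECTURE — **ns.S04**, Clay Millennium statement (D): breakdown of Navier–Stokes
solutions on `ℝ³/ℤ³`, posed by C. Fefferman in the official Clay Mathematics Institute problem
description [cite: FeffermanClay2006, statement (D) with (8) (9) (10) (11)] [status: open] — it
is the Millennium problem itself (the source asks for a proof of one of (A)–(D)); no proof or
disproof exists, so no `_holds` theorem can: never assert it, take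
`(h : NavierStokesBreakdownPeriodic)` as an explicit hypothesis.
Statement (as printed, 2006): for every `ν > 0` there are a smooth, divergence-free,
`ℤ³`-periodic `u₀ : ℝ³ → ℝ³` and a force `f`, smooth on `ℝ³ × [0,∞)`, `ℤ³`-periodic in `x` for
`t ≥ 0` (8) and rapidly decaying in time with all derivatives (9), for which NO `(u, p)`, smooth
on `ℝ³ × [0,∞)` (11) with `u(·, t)` `ℤ³`-periodic for all `t ≥ 0` (10), solves (1), (2), (3)
((10) as printed constrains `u` only; this implies the CMI errata reading, which excludes only
solutions with `p(·, t)` periodic as well: `NavierStokesBreakdownPeriodic.pressurePeriodic`).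
Verdict clean-up 2026-08-15: audited faithful clause by clause, open problem; name and statement
unchanged. -/
@[conjecture] def NavierStokesBreakdownPeriodic : Prop :=
  ∀ ν : ℝ, 0 < ν → ∃ (u₀ : ℝ³ → ℝ³) (f : ℝ → ℝ³ → ℝ³),
    ContDiff ℝ ∞ u₀ ∧ NSWave0.IsDivFree u₀ ∧ IsLatticePeriodic u₀ ∧
    IsSmoothOnHalfSpace f ∧ (∀ t, 0 ≤ t → IsLatticePeriodic (f t)) ∧ HasRapidTimeDecay f ∧
      ¬ ∃ (u : ℝ → ℝ³ → ℝ³) (p : ℝ → ℝ³ → ℝ),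
        IsSmoothOnHalfSpace u ∧ IsSmoothOnHalfSpace p ∧
          IsNavierStokesSolution ν f u₀ u p ∧ ∀ t, 0 ≤ t → IsLatticePeriodic (u t)

end Summit.NavierStokesRegularity.NavierStokesRegularity
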